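import Summits.QuantumFields.YangMills.Theorems.PoincareLipschitzHistoryTailOfQuantile
import Summits.QuantumFields.YangMills.Theorems.PoincareLipschitzBlockLipschitzL
import Summits.QuantumFields.YangMills.Theorems.PoincareLipschitzMesoscopicConcentrationLOfMesoscopicBox
import Summits.QuantumFields.YangMills.Theorems.PoincareLipschitzMeanDeviationOfSecondMoment
import HarnessLib

/-!
# Crux `HistoryTailL` (stmt-QuantumFields-19936) — K2-LANE FACE v13 «(R-node) + (Q)»: the crux from the MESOSCOPIC RESIDUAL NODE of K1′
# (stmt-QuantumFields-23532) and the QUANTILE ROW (Q) of 23133 — no crux-name hypothesis, no unregistered letter on the K1 side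

Cell `ym3-torus` (YM ladder rung R3 = continuum SU(2) Yang–Mills on T³ — a RUNG, NOT d = 4, NOT infinite volume, NOT a mass gap, NOT Clay).
K2-lane face v13, filed on ★★OWNER WORD 41 (2026-08-29 19:27Z) by width seat `ym3-torus-px10` g8 FOR THE LEAD LINEAGE w1 of 19936 (LEAD ★w1-19936 g10
FINAL 19:13:30Z; successor g11 seated 19:28Z, CONCUR 19:28:51Z — faces of record are LEAD files, ★★OWNER RULING №28; any v14+ is the LEAD's).
`--supports stmt-QuantumFields-19936 --as helper`; theorems only; one-line compositions of landed names:
* ✓p725043 px10 g6 T-3 `PoincareLipschitz.MedianCentring.historyTailL_of_quantile (hC : MesoscopicConcentrationL) (hLip : BlockLipschitzL) (hQ)`;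
* ✓p738475 `PoincareLipschitzBlockLipschitzL.blockLipschitzL_proof : BlockLipschitzL` (crux 23533 CLOSED, LEAD ★w1-19936 g10 and company);
* ✓p740183 `PoincareLipschitzMesoscopicConcentrationLOfMesoscopicBox.mesoscopicConcentrationL_of_mesoscopicBox (hR) : MesoscopicConcentrationL`
  (the K1 display face of record, ★★OWNER RECORD 17ae: K1 ⟸ its mesoscopic residual alone, over the bounded-box rung
  ✓`PoincareLipschitzStubBoundedBoxConcentration.stub_boundedBoxConcentration`);
* ✓p731380 px9 g9 `PoincareLipschitzMeanDeviationOfSecondMoment.quantileDeviation_of_secondMoment (hSM) : (Q)`.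

DISPLAYED BINDERS.
* row `hR` = LINE 29 v1.1 (R) = LINE 30 `mesoscopicResidual_of_stubs` node (expired as a registered stub 19:26:09Z); in full: LINE 29 v1.1's
  `stub_mesoscopicBoxConcentration` text = LINE 30 «CurvaturePoincare» `mesoscopicResidual_of_stubs` NODE (skeleton
  `Cruxes/HistoryTailL/Lines/curvature_poincare.lean` e95b7bfb5ac8bc91 on stmt-QuantumFields-23532; the (R) text EXPIRED as a registered stub at
  2026-08-29 19:26:09Z «not in skeleton» and is now CONCLUDED token-for-token (1173 chars) by LINE 30's `mesoscopicResidual_of_stubs` from its four stubs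
  NP `stub_curvaturePinning` · LM `stub_localBoxExpMoment` · B♯ `stub_sqrtPinnedTail` · MD `stub_moderateDeviationResidual`) — the mesoscopic sides
  `17·L³ < n ≤ β_K` of K1′, VERBATIM; XL content, organ-adjacent; NOT proved;
* row `hQ` = (Q) = 23133's registered `stub_quantileDeviation` VERBATIM (429 chars ws-normalised, as on faces v8…v12′); resp. `hSM` = «BlockSecondMomentL» (OPEN,
  UNREGISTERED — ★★OWNER WORD 34's label).
Versus v12′ ✓p738635 (`hK1` = the K1-exp LETTER for ALL box sides + `hQ`): the K1-side row here is a registry∕skeleton-node TEXT on the mesoscopic sides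
only (bounded sides + the Gaussian ⟹ two-sided step discharged in-tree); (R) is Gaussian hence formally stronger than K1-exp there — neither face implies
the other.  NOTHING of (R), (Q), `hSM` or `HistoryTailL` is proved here.

* `historyTailL_of_mesoscopicBox_quantile (hR) (hQ) : UnitScaleTilt.HistoryTailL`
* `historyTailL_of_mesoscopicBox_secondMoment (hR) (hSM) : UnitScaleTilt.HistoryTailL`
HONEST SCOPE.  Display compositions; YM₃ on T³ is rung R3, not Clay; YM gap NOT proved.

References: T. Bałaban, CMP 102 (1985) 255–275 [Balaban1985UV3] ((7) p.257, (71) p.273).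
-/

open MeasureTheory
open scoped BigOperators
open Literature.MathematicalPhysics.QuantumFieldTheory.Balaban1983to89
open Literature.MathematicalPhysics.QuantumFieldTheory.Balaban1983to89.T3ContinuumYM3Torus
open Literature.MathematicalPhysics.QuantumFieldTheory.Balaban1983to89.T3UnitScaleTilt
open Literature.MathematicalPhysics.QuantumFieldTheory.Balaban1983to89.T3UnitLawDensityEML (ℰp)
open Summit.QuantumFields.YangMills.Theorems.PoincareLipschitz.MedianCentring (historyTailL_of_quantile)
open Summit.QuantumFields.YangMills.Theorems.PoincareLipschitzBlockLipschitzL (blockLipschitzL_proof)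
open Summit.QuantumFields.YangMills.Theorems.PoincareLipschitzMesoscopicConcentrationLOfMesoscopicBox (mesoscopicConcentrationL_of_mesoscopicBox)
open Summit.QuantumFields.YangMills.Theorems.PoincareLipschitzMeanDeviationOfSecondMoment (quantileDeviation_of_secondMoment)

namespace Summit.QuantumFields.YangMills.Theorems.PoincareLipschitzHistoryTailOfMesoscopicBox

/-- ★★★ **v13-q: `HistoryTailL` from the mesoscopic residual node (R) of K1′ (LINE 29 v1.1 registered text = LINE 30 `mesoscopicResidual_of_stubs` node) and the
quantile row (Q) (23133's registered `stub_quantileDeviation`) — both displayed verbatim.**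
[cite: Balaban1985UV3, (7) p.257, (71) p.273] -/
theorem historyTailL_of_mesoscopicBox_quantile
    (hR : open Literature.MathematicalPhysics.QuantumFieldTheory.Balaban1983to89 Literature.MathematicalPhysics.QuantumFieldTheory.Balaban1983to89.T3ContinuumYM3Torus in ∀ (L : ℕ), ∃ (Cc cc : ℝ), 0 ≤ Cc ∧ 0 < cc ∧ ∃ γ₁ : ℝ, 0 < γ₁ ∧ γ₁ ≤ 1 ∧ ∀ (F : T3Family) (γ : ℝ), F.L = L → 0 < γ → γ ≤ γ₁ → ∀ (K n : ℕ), 1 ≤ n → (n : ℝ) ≤ (F.scheme T3UnitLawDensityEML.ℰp γ).β K → 2 * n ≤ (F.P K).sitesPerDir 0 → 17 * L ^ 3 < n → ∀ (x₀ : Site (F.P K) 0) (f : GaugeField (F.P K) 0 (Matrix.specialUnitaryGroup (Fin 2) ℂ) → ℝ) (Λ : ℝ), 0 < Λ → Measurable f → GaugeField.GaugeInvariant f → (∀ U U' : GaugeField (F.P K) 0 (Matrix.specialUnitaryGroup (Fin 2) ℂ), (∀ b : PBond (F.P K) 0, (∀ k, (b.src k - x₀ k).val < n) → (∀ k, (b.tgt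 k - x₀ k).val < n) → U b = U' b) → f U = f U') → (∀ U U' : GaugeField (F.P K) 0 (Matrix.specialUnitaryGroup (Fin 2) ℂ), |f U - f U'| ≤ Λ * Real.sqrt (∑ b : PBond (F.P K) 0, GaugeGroup.dist1 (U b * (U' b)⁻¹) ^ 2)) → ∀ r : ℝ, 0 ≤ r → (T3UnitScaleTilt.gibbsK F T3UnitLawDensityEML.ℰp γ K).real {U | r ≤ f U - ∫ V, f V ∂(T3UnitScaleTilt.gibbsK F T3UnitLawDensityEML.ℰp γ K)} ≤ Cc * Real.exp (-(cc * (F.scheme T3UnitLawDensityEML.ℰp γ).β K * r ^ 2 / ((n : ℝ) ^ 2 * Λ ^ 2))))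
    (hQ : ∀ (L : ℕ) (b₀ p₀ : ℝ), 0 < b₀ → 2 < p₀ → ∃ γ₁ : ℝ, 0 < γ₁ ∧ γ₁ ≤ 1 ∧ ∀ (F : T3Family) (γ : ℝ), F.L = L → 0 < γ → γ ≤ γ₁ →
            ∀ (K j : ℕ), 1 ≤ j → j + 2 ≤ K → ∀ a : Plaq (F.P K) j,
              3 / 4 ≤ (gibbsK F ℰp γ K).real {U : GaugeField (F.P K) 0 (Matrix.specialUnitaryGroup (Fin 2) ℂ) | GaugeGroup.dist1 (GaugeField.plaqHol (Averaging.iter (fun i' => BlockAveraging.blockAvg (P := F.P K) (j := i') ℰp) j U) a) ≤ θBal F.L γ b₀ p₀ (K - j) / 8}) :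
    Summit.QuantumFields.YangMills.Theses.UnitScaleTilt.HistoryTailL :=
  historyTailL_of_quantile (mesoscopicConcentrationL_of_mesoscopicBox hR) blockLipschitzL_proof hQ

/-- ★★ **v13-sm: `HistoryTailL` from the mesoscopic residual node (R) and the (unregistered) block second-moment row «BlockSecondMomentL».**
[cite: Balaban1985UV3, (7) p.257, (71) p.273] -/
theorem historyTailL_of_mesoscopicBox_secondMoment
    (hR : open Literature.MathematicalPhysics.QuantumFieldTheory.Balaban1983to89 Literature.MathematicalPhysics.QuantumFieldTheory.Balaban1983to89.T3ContinuumYM3Torus in ∀ (L : ℕ), ∃ (Cc cc : ℝ), 0 ≤ Cc ∧ 0 < cc ∧ ∃ γ₁ : ℝ, 0 < γ₁ ∧ γ₁ ≤ 1 ∧ ∀ (F : T3Family) (γ : ℝ), F.L = L → 0 < γ → γ ≤ γ₁ → ∀ (K n : ℕ), 1 ≤ n → (n : ℝ) ≤ (F.scheme T3UnitLawDensityEML.ℰp γ).β K → 2 * n ≤ (F.P K).sitesPerDir 0 → 17 * L ^ 3 < n → ∀ (x₀ : Site (F.P K) 0) (f : GaugeField (F.P K) 0 (Matrix.specialUnitaryGroup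 (Fin 2) ℂ) → ℝ) (Λ : ℝ), 0 < Λ → Measurable f → GaugeField.GaugeInvariant f → (∀ U U' : GaugeField (F.P K) 0 (Matrix.specialUnitaryGroup (Fin 2) ℂ), (∀ b : PBond (F.P K) 0, (∀ k, (b.src k - x₀ k).val < n) → (∀ k, (b.tgt k - x₀ k).val < n) → U b = U' b) → f U = f U') → (∀ U U' : GaugeField (F.P K) 0 (Matrix.specialUnitaryGroup (Fin 2) ℂ), |f U - f U'| ≤ Λ * Real.sqrt (∑ b : PBond (F.P K) 0, GaugeGroup.dist1 (U b * (U' b)⁻¹) ^ 2)) → ∀ r : ℝ, 0 ≤ r → (T3UnitScaleTilt.gibbsK F T3UnitLawDensityEML.ℰp γ K).real {U | r ≤ f U - ∫ V, f V ∂(T3UnitScaleTilt.gibbsK F T3UnitLawDensityEML.ℰp γ K)} ≤ Cc * Real.exp (-(cc * (F.scheme T3UnitLawDensityEML.ℰp γ).β K * r ^ 2 / ((n : ℝ) ^ 2 * Λ ^ 2))))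
    (hSM : ∀ (L : ℕ), ∃ C : ℝ, 0 ≤ C ∧ ∃ γ₁ : ℝ, 0 < γ₁ ∧ γ₁ ≤ 1 ∧ ∀ (F : T3Family) (γ : ℝ), F.L = L → 0 < γ → γ ≤ γ₁ →
          ∀ (K j : ℕ), 1 ≤ j → j ≤ K → ∀ a : Plaq (F.P K) j,
            ∫ U, (GaugeGroup.dist1 (GaugeField.plaqHol (Averaging.iter (fun i' => BlockAveraging.blockAvg (P := F.P K) (j := i') ℰp) j U) a)) ^ 2 ∂(gibbsK F ℰp γ K)
              ≤ C * (γ * ((F.L : ℝ)⁻¹) ^ (K - j))) :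
    Summit.QuantumFields.YangMills.Theses.UnitScaleTilt.HistoryTailL :=
  historyTailL_of_mesoscopicBox_quantile hR (quantileDeviation_of_secondMoment hSM)

end Summit.QuantumFields.YangMills.Theorems.PoincareLipschitzHistoryTailOfMesoscopicBox
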